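/-
Copyright (c) 2026 the pub-hodgecm-mathlib formalisation cell (harness21).  Prover fan seat hodgecm-mathlib-LH7-p05 (g3) (F0 ∕ P3c ∕ LH7, lent to
Track B «K2-LIT» by K1a DESK WORD #14 (2), K2Liu-p01 (g11)), hLiu418 = `stmt-HodgeConjecture-24832`; spec = K2E4-p10 (g10)'s HANDOFF (G-b).  THEOREMS ONLY
(no `def`, no instance, no notation, no named-fact hypothesis, no `sorry`); lane `--supports stmt-HodgeConjecture-24832 --as helper`.
-/
import Summits.HodgeConjecture.HodgeConjecture.Theorems.K2LiuArchTwistedScalarLettersExplicit    -- ★ p864004: the explicit continued formula (§1's lambda)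
import Summits.HodgeConjecture.HodgeConjecture.Theorems.K2LiuArchSiegelHalfSpaceHeightBounds      -- ★ (m2) p864583: `det denom(h,i1)^{±1}`, `det Im(h·i1)^{-1}` vs entries
import Summits.HodgeConjecture.HodgeConjecture.Theorems.K2LiuHermTwoEtaRankOneWitnessGrowth      -- ★ (G-a) p864645: envelope bookkeeping + `norm_jIntegral_le_env`
import Summits.HodgeConjecture.HodgeConjecture.Theorems.K2LiuKindWArchWhittakerGrowth            -- ★ `norm_cexp_trace_mul_of_isHermitian` (unimodular character)
import HarnessLib

/-!
# Crux `HLiu418`, socket #41, KIND 1 a♮ — (iv-G-b) `K2LiuArchTwistedScalarLettersGrowth`: the SCALAR TYPE of ★ p864004's explicit continued archimedean letter,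
# `‖Ac s h‖ ≤ Cg·Sz^{Mg}·exp(−π·p(h)·t)` near every `z` with `0 < re z`, constants depending on `(k, N, z)` ONLY

Cell `hodgecm-mathlib`, hLiu418 = `stmt-HodgeConjecture-24832` (helper lane, count-neutral); squad K2 ∕ K2Liu, road `K2_Liu`, KIND 1 a♮; K1a desk K2Liu-p01 (g11); spec K2E4-p10
(g10) HANDOFF (G-b).  CONSUMER: K2Liu-p03 (g8)'s (iv) slot `hAcwb` of ★ p864498 `hAcb_of_archLetters` («`‖Acw X i w s h‖ ≤ Cg·Pw^{Mg}·exp(−cg·gw)`, `Mg Cg cg rg` chosen BEFORE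
`X, s, h`»), read with `Pw := Sz = E(p_w,t_w)·(1+R(h))`, `gw := p_w(h)·t_w`, `cg := π`, where `E(p,t) := (1+p)(1+p⁻¹)(1+t)(1+t⁻¹) ≥ 1`, `Sz := E·(1+R) ≥ 1`.
THE MATHEMATICS ([Shimura1982, §4 Thm. 4.2, (4.34.K)]; [Shimura1997, §16.4, §18.4–18.5]).  ★ p864004's letter at `h ∈ U(J)` (entries `≤ R`), `T = a·diag(t,0)·aᴴ` (`‖det a‖ = 1`,
`t > 0`) is `δ^{−k}|δ|^{k−2s−2}·e(tr(T·Re τ))·(1∕8)(4π⁴e^{−πik}·π⁻²Γ(s+1+k∕2)⁻¹Γ(s+k∕2)⁻¹Γ(s+1−k∕2)⁻¹·(π∕p)e^{−πpt}·(p∕det g)^{2s}Γ(2s)·Φ(1+k∕2)(1−k∕2) p s)`, `τ = h·(i1)`,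
`δ = det denom(h,i1)`, `V = Im τ`, `g = aᴴ(2V)a = [[p,w],[w̄,q]]`.  Factorwise on `dist s z < min(1, re z∕2, r_Φ)`: `|δ|^{x} ≤ ((1+|δ|)(1+|δ|⁻¹))^{⌈X⌉} ≤ (256·Sz⁴)^{n₁}` (★ (m2):
`|δ| ≤ 8R²`, `|δ|⁻¹ ≤ 32R²`; ★ (G-a) `rpow_le_envFactor_pow`); the character and `e^{−πik}` are unimodular; the three `Γ⁻¹` are entire (bounded on `closedBall z 1`);
`‖π∕p‖ ≤ π·Sz`; `‖e^{−pπt}‖ = e^{−π(pt)}` IS the Gaussian; `p∕det g = p∕(4·det V) ≤ 16R⁴p ≤ 16·Sz⁵` (★ `det_hermTwo`, ★ (m2) `inv_norm_det_im_moeb_I_le`), exponent `2re s ∈ (0, n₂]`;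
`Γ(2s)` is bounded on `closedBall z (re z∕2)`; `Φ ≤ C·E^K ≤ C·Sz^K` by §0 = ★ p864645 `norm_witness_le` with its binders RE-ORDERED (`K C r` from `(α₀, β₀, z, N)` BEFORE `t` and
the witness `Φ` — ★ p864645's proof verbatim up to the order of `intro`s; K2E4-p10's seat is closed, so the uniform edition is hosted here).  §1 = two scalar lemmas + the head.
HONEST LABEL.  Elementary estimates, count-neutral; they close no socket: `HC_CM` is proved only modulo the 7 printed citations (2 remaining named inputs: hLiu418 =
`stmt-HodgeConjecture-24832`, h413 = `stmt-HodgeConjecture-24833`) until rung 0 closes.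
-/

set_option autoImplicit false
set_option linter.dupNamespace false -- the mandated namespace repeats `HodgeConjecture.HodgeConjecture`

noncomputable section

open Complex MeasureTheory Set Filter Metric Matrix
open scoped ComplexOrder ComplexConjugate

namespace Summit.HodgeConjecture.HodgeConjecture.Cruxes.HLiu418.K2LiuArchTwistedScalarLettersGrowth

open Literature.NumberTheory.ModularForms.SiegelUpperHalfSpace (num denom moeb)
open Summit.HodgeConjecture.HodgeConjecture.Cruxes.HLiu418.K2LiuHermTwoGammaDefs
open Summit.HodgeConjecture.HodgeConjecture.Cruxes.HLiu418.K2LiuHermTwoEtaDefs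
open Summit.HodgeConjecture.HodgeConjecture.Cruxes.HLiu418.K2LiuHermitianTubeCocycle
open Summit.HodgeConjecture.HodgeConjecture.Cruxes.HLiu418.K2LiuLocalKernelArchPlaceFactor (differentiableOn_Gamma_two_mul)
open Summit.HodgeConjecture.HodgeConjecture.Cruxes.HLiu418.K2LiuArchSiegelHalfSpaceHeightBounds (norm_det_denom_I_le norm_det_denom_I_inv_le inv_norm_det_im_moeb_I_le)
open Summit.HodgeConjecture.HodgeConjecture.Cruxes.HLiu418.K2LiuHermTwoEtaRankOneWitnessGrowth (one_le_envFactor rpow_le_envFactor_pow Gamma_le_add_of_mem_Icc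
  norm_jIntegral_le_env)
open Summit.HodgeConjecture.HodgeConjecture.Cruxes.HLiu418.K2LiuKindWArchWhittakerGrowth (norm_cexp_trace_mul_of_isHermitian)

/-! ## §0 ★ p864645 with the constants chosen before `t` and the witness -/

/-- **GROWTH OF ANY WITNESS, UNIFORMLY IN `t` AND IN THE WITNESS** (by the unrolling depth `j ≤ N`): for `1 − j < re(β₁+z)` there are `K C r` — depending on
`(α₀, β₁, z, j)` ONLY — with `‖Φ α₀ β₁ p s‖ ≤ C·E(p,t)^K` for every `t > 0`, every `Φ` satisfying ★ p863550's letters (b) (at `t`) and (c) (at depth `N`), every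
`p > 0` and `dist s z < r`.  (★ p864645 `norm_witness_le_aux`∕`norm_witness_le`, binders re-ordered; use at `j = N`.) [cite: Shimura1982, §3 Thm. 3.1] [cite: Shimura1997, §16.4] -/
theorem norm_witness_le_uniform (N : ℕ) :
    ∀ j : ℕ, j ≤ N → ∀ (α₀ β₁ z : ℂ), 1 - (j : ℝ) < (β₁ + z).re →
      ∃ (K : ℕ) (C r : ℝ), 0 ≤ C ∧ 0 < r ∧ ∀ (t : ℝ), 0 < t → ∀ (Φ : ℂ → ℂ → ℝ → ℂ → ℂ),
        (∀ (α₀ β₀ : ℂ) (p : ℝ), 0 < p → ∀ s : ℂ, 1 < (β₀ + s).re → Φ α₀ β₀ p s = (Complex.Gamma (β₀ + s - 1))⁻¹ *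
          ∫ r in Ioi (0 : ℝ), cexp (-((p * r : ℝ) : ℂ)) * ((((r + 2 * t : ℝ)) : ℂ) ^ (α₀ + s - 2) * ((r : ℝ) : ℂ) ^ (β₀ + s - 2))) →
        (∀ (α₀ β₀ : ℂ) (p : ℝ), 0 < p → ∀ s : ℂ, 1 - N < (β₀ + s).re →
          Φ α₀ β₀ p s = (p : ℂ) * Φ α₀ (β₀ + 1) p s - (α₀ + s - 2) * Φ (α₀ - 1) (β₀ + 1) p s) →
        ∀ p : ℝ, 0 < p → ∀ s : ℂ, dist s z < r →
          ‖Φ α₀ β₁ p s‖ ≤ C * (((1 + p) * (1 + p⁻¹)) * ((1 + t) * (1 + t⁻¹))) ^ K := by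
  intro j
  induction j with
  | zero =>
    intro _ α₀ β₁ z hz
    simp only [Nat.cast_zero, sub_zero] at hz
    set r : ℝ := min (((β₁ + z).re - 1) / 2) 1 with hr
    have hr0 : 0 < r := lt_min (by linarith) one_pos
    have hr1 : r ≤ 1 := min_le_right _ _
    have hr2 : r ≤ ((β₁ + z).re - 1) / 2 := min_le_left _ _
    have hcont : ContinuousOn (fun s : ℂ => (Complex.Gamma (β₁ + s - 1))⁻¹) (closedBall z r) :=
      ((Complex.differentiable_one_div_Gamma.comp (((differentiable_id).const_add β₁).sub_const 1)).continuous).continuousOn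
    obtain ⟨CΓ, hCΓ⟩ := (isCompact_closedBall z r).exists_bound_of_continuousOn hcont
    have hCΓ0 : 0 ≤ CΓ := (norm_nonneg _).trans (hCΓ z (mem_closedBall_self hr0.le))
    set A : ℝ := |(α₀ + z - 2).re| + 1 with hAdef
    set u : ℝ := ((β₁ + z).re - 1) / 2 with hudef
    set v : ℝ := (β₁ + z).re with hvdef
    have hu : 0 < u := by rw [hudef]; linarith
    set CJ : ℝ := (2 : ℝ) ^ ⌈A⌉₊ * (Real.Gamma u + Real.Gamma (A + v)) + (4 : ℝ) ^ ⌈A⌉₊ * (Real.Gamma u + Real.Gamma v) with hCJ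
    have hA0 : 0 ≤ A := by positivity
    have hCJ0 : 0 ≤ CJ := by
      have := (Real.Gamma_pos_of_pos hu).le
      have := (Real.Gamma_pos_of_pos (hu.trans_le (by rw [hudef, hvdef]; linarith) : 0 < v)).le
      have := (Real.Gamma_pos_of_pos (by linarith : 0 < A + v)).le
      positivity
    refine ⟨⌈A + v⌉₊ + ⌈A⌉₊ + ⌈v⌉₊, CΓ * CJ, r, mul_nonneg hCΓ0 hCJ0, hr0, fun t ht Φ hΦb _ p hp s hs => ?_⟩
    have hsz : ‖s - z‖ < r := by rwa [← dist_eq_norm]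
    have hre : |(s - z).re| < r := (abs_re_le_norm _).trans_lt hsz
    have hre' := abs_lt.1 hre
    have hs1 : 1 < (β₁ + s).re := by
      have : (β₁ + s).re = (β₁ + z).re + (s - z).re := by simp only [add_re, sub_re]; ring
      rw [this]; linarith
    rw [hΦb α₀ β₁ p hp s hs1, norm_mul, mul_assoc]
    refine mul_le_mul (hCΓ s (mem_closedBall.2 hs.le)) (norm_jIntegral_le_env hp ht ?_ hu ?_ ?_) (norm_nonneg _) hCΓ0
    · -- `|re(α₀+s−2)| ≤ |re(α₀+z−2)| + 1`
      have : (α₀ + s - 2).re = (α₀ + z - 2).re + (s - z).re := by simp only [add_re, sub_re]; ring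
      rw [this]
      exact (abs_add_le _ _).trans (by linarith [le_of_lt hre])
    · have : (β₁ + s - 2).re + 1 = (β₁ + z).re - 1 + (s - z).re := by simp only [add_re, sub_re, re_ofNat]; ring
      rw [this, hudef]; linarith
    · have : (β₁ + s - 2).re + 1 = (β₁ + z).re - 1 + (s - z).re := by simp only [add_re, sub_re, re_ofNat]; ring
      rw [this, hvdef]; linarith
  | succ j ih =>
    intro hj α₀ β₁ z hz
    have hjN : j ≤ N := Nat.le_of_succ_le hj
    have hz1 : 1 - (j : ℝ) < (β₁ + 1 + z).re := by
      simp only [Nat.cast_succ, add_re, one_re] at hz ⊢; linarith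
    obtain ⟨K₁, C₁, r₁, hC₁, hr₁, hB₁⟩ := ih hjN α₀ (β₁ + 1) z hz1
    obtain ⟨K₂, C₂, r₂, hC₂, hr₂, hB₂⟩ := ih hjN (α₀ - 1) (β₁ + 1) z hz1
    have hmargin : 0 < (β₁ + z).re - (1 - N) := by
      have : (j : ℝ) + 1 ≤ N := by exact_mod_cast hj
      simp only [Nat.cast_succ] at hz; linarith
    set r : ℝ := min (min r₁ r₂) (min 1 (((β₁ + z).re - (1 - N)) / 2)) with hr
    have hr0 : 0 < r := lt_min (lt_min hr₁ hr₂) (lt_min one_pos (by linarith))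
    refine ⟨K₁ + K₂ + 1, C₁ + (‖α₀‖ + ‖z‖ + 3) * C₂, r, by positivity, hr0, fun t ht Φ hΦb hΦc p hp s hs => ?_⟩
    have hs₁ : dist s z < r₁ := lt_of_lt_of_le hs ((min_le_left _ _).trans (min_le_left _ _))
    have hs₂ : dist s z < r₂ := lt_of_lt_of_le hs ((min_le_left _ _).trans (min_le_right _ _))
    have hs1 : dist s z < 1 := lt_of_lt_of_le hs ((min_le_right _ _).trans (min_le_left _ _))
    have hsm : dist s z < ((β₁ + z).re - (1 - N)) / 2 := lt_of_lt_of_le hs ((min_le_right _ _).trans (min_le_right _ _))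
    have hsz : ‖s - z‖ = dist s z := (dist_eq_norm _ _).symm
    have hre : |(s - z).re| ≤ dist s z := hsz ▸ abs_re_le_norm _
    have hsN : 1 - (N : ℝ) < (β₁ + s).re := by
      have : (β₁ + s).re = (β₁ + z).re + (s - z).re := by simp only [add_re, sub_re]; ring
      rw [this]; linarith [(abs_le.1 hre).1]
    set E : ℝ := ((1 + p) * (1 + p⁻¹)) * ((1 + t) * (1 + t⁻¹)) with hE
    have hE1 : 1 ≤ E := by
      have := one_le_envFactor hp; have := one_le_envFactor ht; rw [hE]; nlinarith
    have hpE : 1 + p ≤ E := by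
      rw [hE]
      calc 1 + p ≤ (1 + p) * (1 + p⁻¹) := le_mul_of_one_le_right (by linarith) (by linarith [inv_pos.2 hp])
        _ ≤ _ := le_mul_of_one_le_right (by nlinarith [inv_pos.2 hp]) (one_le_envFactor ht)
    have b1 := hB₁ t ht Φ hΦb hΦc p hp s hs₁
    have b2 := hB₂ t ht Φ hΦb hΦc p hp s hs₂
    have hcoef : ‖α₀ + s - 2‖ ≤ ‖α₀‖ + ‖z‖ + 3 := by
      have h1 : ‖s‖ ≤ ‖z‖ + 1 := by
        calc ‖s‖ = ‖z + (s - z)‖ := by congr 1; ring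
          _ ≤ ‖z‖ + ‖s - z‖ := norm_add_le _ _
          _ ≤ ‖z‖ + 1 := by rw [hsz]; linarith
      calc ‖α₀ + s - 2‖ ≤ ‖α₀ + s‖ + ‖(2 : ℂ)‖ := norm_sub_le _ _
        _ ≤ ‖α₀‖ + ‖s‖ + 2 := by rw [Complex.norm_ofNat]; linarith [norm_add_le α₀ s]
        _ ≤ _ := by linarith
    have hK1 : E ^ K₁ * E ≤ E ^ (K₁ + K₂ + 1) := by
      rw [← pow_succ]; exact pow_le_pow_right₀ hE1 (by omega)
    have hK2 : E ^ K₂ ≤ E ^ (K₁ + K₂ + 1) := pow_le_pow_right₀ hE1 (by omega)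
    rw [hΦc α₀ β₁ p hp s hsN]
    calc ‖(p : ℂ) * Φ α₀ (β₁ + 1) p s - (α₀ + s - 2) * Φ (α₀ - 1) (β₁ + 1) p s‖
        ≤ ‖(p : ℂ) * Φ α₀ (β₁ + 1) p s‖ + ‖(α₀ + s - 2) * Φ (α₀ - 1) (β₁ + 1) p s‖ := norm_sub_le _ _
      _ ≤ (1 + p) * (C₁ * E ^ K₁) + (‖α₀‖ + ‖z‖ + 3) * (C₂ * E ^ K₂) := by
          rw [norm_mul, norm_mul, Complex.norm_real, Real.norm_of_nonneg hp.le]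
          exact add_le_add (mul_le_mul (by linarith) b1 (norm_nonneg _) (by linarith)) (mul_le_mul hcoef b2 (norm_nonneg _) (by positivity))
      _ ≤ E * (C₁ * E ^ K₁) + (‖α₀‖ + ‖z‖ + 3) * (C₂ * E ^ K₂) := by
          have : 0 ≤ C₁ * E ^ K₁ := by positivity
          nlinarith
      _ = C₁ * (E ^ K₁ * E) + (‖α₀‖ + ‖z‖ + 3) * C₂ * E ^ K₂ := by ring
      _ ≤ C₁ * E ^ (K₁ + K₂ + 1) + (‖α₀‖ + ‖z‖ + 3) * C₂ * E ^ (K₁ + K₂ + 1) :=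
          add_le_add (mul_le_mul_of_nonneg_left hK1 hC₁) (mul_le_mul_of_nonneg_left hK2 (by positivity))
      _ = (C₁ + (‖α₀‖ + ‖z‖ + 3) * C₂) * E ^ (K₁ + K₂ + 1) := by ring

/-! ## §1 Two scalar inequalities, then the scalar-type bound of the explicit continued letter -/

/-- `q ≤ (1+q)(1+q⁻¹)` and `q⁻¹ ≤ (1+q)(1+q⁻¹)` for `q > 0` (the envelope dominates both signs). [folklore] -/
theorem le_envFactor {q : ℝ} (hq : 0 < q) : q ≤ (1 + q) * (1 + q⁻¹) ∧ q⁻¹ ≤ (1 + q) * (1 + q⁻¹) := by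
  have hqi := inv_pos.2 hq
  have h1 : q * q⁻¹ = 1 := mul_inv_cancel₀ hq.ne'
  constructor <;> nlinarith [h1, hqi]

/-- `(1+x)(1+x⁻¹) ≤ 256·(1+R)⁴` when `x ≤ 8R²` and `x⁻¹ ≤ 32R²` (`R ≥ 0`): the envelope of `|det denom(h, i1)|` at `m = 2`. [folklore] -/
theorem envFactor_le_of_sq_bounds {x R : ℝ} (hx : 0 < x) (hR : 0 ≤ R) (h1 : x ≤ 8 * R ^ 2) (h2 : x⁻¹ ≤ 32 * R ^ 2) :
    (1 + x) * (1 + x⁻¹) ≤ 256 * (1 + R) ^ 4 := by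
  have hR2 : 0 ≤ R ^ 2 := by positivity
  have hR3 : 0 ≤ R ^ 3 := by positivity
  have hx1 : 0 ≤ 1 + x⁻¹ := by positivity
  calc (1 + x) * (1 + x⁻¹) ≤ (1 + 8 * R ^ 2) * (1 + 32 * R ^ 2) := mul_le_mul (by linarith) (by linarith) hx1 (by positivity)
    _ ≤ 256 * (1 + R) ^ 4 := by nlinarith


/-- **THE SCALAR TYPE OF ★ p864004's EXPLICIT CONTINUED LETTER** (non-negative index `T = a·diag(t,0)·aᴴ`, `‖det a‖ = 1`, `t > 0`, `k∕2 < N`): for every `z` with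
`0 < re z` there are `Mg Cg r` — depending on `(k, N, z)` ONLY — such that for every `t > 0`, every depth-`N` witness `Φ` of ★ p863550 (letters (b)(c) by
value), every `a` with `‖det a‖ = 1`, every `h ∈ U(J)` with entries `≤ R`, and every `s` with `dist s z < r`:
`‖(continued formula at s)‖ ≤ Cg · (((1+p)(1+p⁻¹))·((1+t)(1+t⁻¹))·(1+R))^{Mg} · exp(−π·(p·t))`, `p = p(h) = Re (aᴴ(2·Im(h·i1))a)₀₀` the Gaussian
parameter.  (Polynomial size `Sz ≥ 1`, Gaussian exponent `p·t`, rate `π`: the (iv) `hAcwb` shape of ★ p864498.) [cite: Shimura1982, §4 Thm. 4.2, (4.34.K)]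
[cite: Shimura1997, §16.4, §18.4–18.5] -/
theorem norm_continuedFormula_le (k : ℤ) (N : ℕ) (hN : (k : ℝ) / 2 < N) (z : ℂ) (hz : 0 < z.re) :
    ∃ (Mg : ℕ) (Cg r : ℝ), 0 ≤ Cg ∧ 0 < r ∧
      ∀ (t : ℝ), 0 < t → ∀ (Φ : ℂ → ℂ → ℝ → ℂ → ℂ),
        (∀ (α₀ β₀ : ℂ) (p : ℝ), 0 < p → ∀ s : ℂ, 1 < (β₀ + s).re → Φ α₀ β₀ p s = (Complex.Gamma (β₀ + s - 1))⁻¹ *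
          ∫ r in Ioi (0 : ℝ), cexp (-((p * r : ℝ) : ℂ)) * ((((r + 2 * t : ℝ)) : ℂ) ^ (α₀ + s - 2) * ((r : ℝ) : ℂ) ^ (β₀ + s - 2))) →
        (∀ (α₀ β₀ : ℂ) (p : ℝ), 0 < p → ∀ s : ℂ, 1 - N < (β₀ + s).re →
          Φ α₀ β₀ p s = (p : ℂ) * Φ α₀ (β₀ + 1) p s - (α₀ + s - 2) * Φ (α₀ - 1) (β₀ + 1) p s) →
        ∀ (a : Matrix (Fin 2) (Fin 2) ℂ), ‖a.det‖ = 1 →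
        ∀ (h : Matrix (Fin 2 ⊕ Fin 2) (Fin 2 ⊕ Fin 2) ℂ), hᴴ * Matrix.J (Fin 2) ℂ * h = Matrix.J (Fin 2) ℂ →
        ∀ (R : ℝ), (∀ i j, ‖h i j‖ ≤ R) → ∀ s : ℂ, dist s z < r →
          ‖((denom h (I • (1 : Matrix (Fin 2) (Fin 2) ℂ))).det ^ (-k) *
              (((‖(denom h (I • (1 : Matrix (Fin 2) (Fin 2) ℂ))).det‖ : ℝ)) : ℂ) ^ ((k : ℂ) - 2 * s - 2) *
              cexp ((2 * Real.pi * I) * ((a * hermTwo (t, 0, 0) * aᴴ) * ((2 : ℂ)⁻¹ • (moeb h (I • (1 : Matrix (Fin 2) (Fin 2) ℂ)) + (moeb h (I • (1 : Matrix (Fin 2) (Fin 2) ℂ)))ᴴ))).trace)) *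
            ((1 / 8 : ℂ) * ((((4 * Real.pi ^ 4 : ℝ)) : ℂ) * cexp ((Real.pi * I) * ((s + 1 - k / 2) - (s + 1 + k / 2))) *
              ((Real.pi : ℂ)⁻¹ * (Complex.Gamma (s + 1 + k / 2))⁻¹ * (Complex.Gamma (s + 1 + k / 2 - 1))⁻¹) *
              ((Real.pi : ℂ)⁻¹ * (Complex.Gamma (s + 1 - k / 2))⁻¹) *
              ((Real.pi : ℂ) / (((aᴴ * ((2 : ℂ) • ((2 * I)⁻¹ • (moeb h (I • (1 : Matrix (Fin 2) (Fin 2) ℂ)) - (moeb h (I • (1 : Matrix (Fin 2) (Fin 2) ℂ)))ᴴ))) * a) 0 0).re) * cexp (-(((((aᴴ * ((2 : ℂ) • ((2 * I)⁻¹ • (moeb h (I • (1 : Matrix (Fin 2) (Fin 2) ℂ)) - (moeb h (I • (1 : Matrix (Fin 2) (Fin 2) ℂ)))ᴴ))) * a) 0 0).re) * (Real.pi * t) : ℝ) : ℂ)) *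
                ((1 / (((((aᴴ * ((2 : ℂ) • ((2 * I)⁻¹ • (moeb h (I • (1 : Matrix (Fin 2) (Fin 2) ℂ)) - (moeb h (I • (1 : Matrix (Fin 2) (Fin 2) ℂ)))ᴴ))) * a) 1 1).re) - normSq ((aᴴ * ((2 : ℂ) • ((2 * I)⁻¹ • (moeb h (I • (1 : Matrix (Fin 2) (Fin 2) ℂ)) - (moeb h (I • (1 : Matrix (Fin 2) (Fin 2) ℂ)))ᴴ))) * a) 0 1) / (((aᴴ * ((2 : ℂ) • ((2 * I)⁻¹ • (moeb h (I • (1 : Matrix (Fin 2) (Fin 2) ℂ)) - (moeb h (I • (1 : Matrix (Fin 2) (Fin 2) ℂ)))ᴴ))) * a) 0 0).re) : ℝ) : ℂ)) ^ ((s + 1 + k / 2) + (s + 1 - k / 2) - 2) * Complex.Gamma (2 * s)) *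
              Φ (1 + k / 2) (1 - k / 2) (((aᴴ * ((2 : ℂ) • ((2 * I)⁻¹ • (moeb h (I • (1 : Matrix (Fin 2) (Fin 2) ℂ)) - (moeb h (I • (1 : Matrix (Fin 2) (Fin 2) ℂ)))ᴴ))) * a) 0 0).re) s)))‖ ≤
            Cg * ((((1 + ((aᴴ * ((2 : ℂ) • ((2 * I)⁻¹ • (moeb h (I • (1 : Matrix (Fin 2) (Fin 2) ℂ)) - (moeb h (I • (1 : Matrix (Fin 2) (Fin 2) ℂ)))ᴴ))) * a) 0 0).re) *
                (1 + (((aᴴ * ((2 : ℂ) • ((2 * I)⁻¹ • (moeb h (I • (1 : Matrix (Fin 2) (Fin 2) ℂ)) - (moeb h (I • (1 : Matrix (Fin 2) (Fin 2) ℂ)))ᴴ))) * a) 0 0).re)⁻¹)) *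
                ((1 + t) * (1 + t⁻¹))) * (1 + R)) ^ Mg *
              Real.exp (-(Real.pi * ((((aᴴ * ((2 : ℂ) • ((2 * I)⁻¹ • (moeb h (I • (1 : Matrix (Fin 2) (Fin 2) ℂ)) - (moeb h (I • (1 : Matrix (Fin 2) (Fin 2) ℂ)))ᴴ))) * a) 0 0).re) * t))) := by
  /- the constants: §0's package for `Φ (1 + k/2) (1 − k/2)`, the three `Γ⁻¹` on `closedBall z 1`, `Γ(2s)` on `closedBall z (re z/2)`, the two exponent caps -/
  have hzΦ : 1 - (N : ℝ) < ((1 - (k : ℂ) / 2) + z).re := by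
    simp only [add_re, sub_re, one_re, div_ofNat_re, intCast_re]; linarith
  obtain ⟨K, CΦ, rΦ, hCΦ, hrΦ, hΦbd⟩ := norm_witness_le_uniform N N le_rfl (1 + (k : ℂ) / 2) (1 - (k : ℂ) / 2) z hzΦ
  have hΓi : ∀ f : ℂ → ℂ, Differentiable ℂ f → ∃ C : ℝ, 0 ≤ C ∧ ∀ s ∈ closedBall z 1, ‖(Complex.Gamma (f s))⁻¹‖ ≤ C := fun f hf => by
    have hcont : ContinuousOn (fun s : ℂ => (Complex.Gamma (f s))⁻¹) (closedBall z 1) :=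
      ((Complex.differentiable_one_div_Gamma.comp hf).continuous).continuousOn
    obtain ⟨C, hC⟩ := (isCompact_closedBall z 1).exists_bound_of_continuousOn hcont
    exact ⟨C, (norm_nonneg _).trans (hC z (mem_closedBall_self zero_le_one)), hC⟩
  obtain ⟨C₁, hC₁0, hC₁⟩ := hΓi (fun s => s + 1 + (k : ℂ) / 2) (((differentiable_id).add_const _).add_const _)
  obtain ⟨C₂, hC₂0, hC₂⟩ := hΓi (fun s => s + 1 + (k : ℂ) / 2 - 1) ((((differentiable_id).add_const _).add_const _).sub_const _)
  obtain ⟨C₃, hC₃0, hC₃⟩ := hΓi (fun s => s + 1 - (k : ℂ) / 2) (((differentiable_id).add_const _).sub_const _)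
  have hΓ2 : ∃ C₄ : ℝ, 0 ≤ C₄ ∧ ∀ s ∈ closedBall z (z.re / 2), ‖Complex.Gamma (2 * s)‖ ≤ C₄ := by
    have hsub : closedBall z (z.re / 2) ⊆ {s : ℂ | 0 < s.re} := fun s hs => by
      have h1 : ‖s - z‖ ≤ z.re / 2 := by rw [← dist_eq_norm]; exact mem_closedBall.1 hs
      have h2 := (abs_le.1 ((abs_re_le_norm (s - z)).trans h1)).1
      simp only [mem_setOf_eq, sub_re] at h2 ⊢; linarith
    obtain ⟨C, hC⟩ := (isCompact_closedBall z (z.re / 2)).exists_bound_of_continuousOn (differentiableOn_Gamma_two_mul.continuousOn.mono hsub)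
    exact ⟨C, (norm_nonneg _).trans (hC z (mem_closedBall_self (by positivity))), hC⟩
  obtain ⟨C₄, hC₄0, hC₄⟩ := hΓ2
  set n₁ : ℕ := ⌈|(k : ℝ)| + 2 * z.re + 4⌉₊
  set n₂ : ℕ := ⌈2 * z.re + 2⌉₊
  refine ⟨4 * n₁ + 4 * n₁ + 1 + 5 * n₂ + K,
    (256 : ℝ) ^ n₁ * (256 : ℝ) ^ n₁ * (1 / 8) * (4 * Real.pi ^ 4) * (Real.pi⁻¹ * C₁ * C₂) * (Real.pi⁻¹ * C₃) * Real.pi * ((16 : ℝ) ^ n₂ * C₄) * CΦ,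
    min (min 1 (z.re / 2)) rΦ, by positivity, lt_min (lt_min one_pos (by positivity)) hrΦ, ?_⟩
  intro t ht Φ hΦb hΦc a hdet h hh R hR s hs
  have hs1 : dist s z < 1 := lt_of_lt_of_le hs ((min_le_left _ _).trans (min_le_left _ _))
  have hs2 : dist s z < z.re / 2 := lt_of_lt_of_le hs ((min_le_left _ _).trans (min_le_right _ _))
  have hsΦ : dist s z < rΦ := lt_of_lt_of_le hs (min_le_right _ _)
  have hsre : |(s - z).re| ≤ dist s z := by rw [dist_eq_norm]; exact abs_re_le_norm _
  have hsre1 := abs_le.1 (hsre.trans hs1.le)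
  have hsre2 := abs_le.1 (hsre.trans hs2.le)
  have hres0 : 0 < s.re := by rw [sub_re] at hsre2; linarith [hsre2.1]
  have hres1 : |s.re| ≤ z.re + 1 := by rw [sub_re] at hsre1; rw [abs_le]; constructor <;> linarith [hsre1.1, hsre1.2]
  set V : Matrix (Fin 2) (Fin 2) ℂ := ((2 * I)⁻¹ • (moeb h (I • (1 : Matrix (Fin 2) (Fin 2) ℂ)) - (moeb h (I • (1 : Matrix (Fin 2) (Fin 2) ℂ)))ᴴ)) with hV
  set g : Matrix (Fin 2) (Fin 2) ℂ := aᴴ * ((2 : ℂ) • V) * a with hg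
  set P : ℝ := (g 0 0).re with hP
  set Q : ℝ := (g 1 1).re with hQ
  set w : ℂ := g 0 1 with hw
  set δ : ℂ := (denom h (I • (1 : Matrix (Fin 2) (Fin 2) ℂ))).det with hδ
  set E : ℝ := ((1 + P) * (1 + P⁻¹)) * ((1 + t) * (1 + t⁻¹)) with hE
  set Sz : ℝ := E * (1 + R) with hSz
  /- positivity of the weight coordinates (as in ★ p864004 §1) and the determinant identity `PQ − |w|² = 4·|det V|` -/
  have ha0 : a.det ≠ 0 := fun h0 => by rw [h0, norm_zero] at hdet; exact zero_ne_one hdet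
  have haU : IsUnit a := (Matrix.isUnit_iff_isUnit_det a).mpr (Ne.isUnit ha0)
  have hδ0 : δ ≠ 0 := (isUnit_det_denom hh posDef_im_I_smul_one).ne_zero
  have hδpos : 0 < ‖δ‖ := norm_pos_iff.mpr hδ0
  have hVpos : V.PosDef := posDef_im_moeb hh posDef_im_I_smul_one
  have h2V : ((2 : ℂ) • V).PosDef := by
    have h2 := hVpos.smul (by norm_num : (0 : ℝ) < 2)
    rwa [show ((2 : ℝ) • V) = ((2 : ℂ) • V) by rw [← Complex.coe_smul]; norm_num] at h2
  have hg' : g.PosDef := by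
    have := Matrix.IsUnit.posDef_star_left_conjugate_iff (x := (2 : ℂ) • V) haU
    rw [Matrix.star_eq_conjTranspose] at this
    exact this.mpr h2V
  have he : hermTwo (P, w, Q) = g := hermTwo_eq_of_isHermitian hg'.1
  have hg'' : (hermTwo (P, w, Q)).PosDef := by rw [he]; exact hg'
  obtain ⟨hp, hpq⟩ := (posDef_hermTwo_iff _).mp hg''
  simp only at hp hpq
  have hdetg : g.det = ((P * Q - normSq w : ℝ) : ℂ) := by rw [← he, det_hermTwo]
  have hnormg : ‖g.det‖ = 4 * ‖V.det‖ := by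
    rw [hg, det_mul, det_mul, det_conjTranspose, det_smul, Fintype.card_fin]
    simp only [norm_mul, norm_pow, Complex.star_def, Complex.norm_conj, hdet, Complex.norm_ofNat]
    norm_num
  have hPQ : P * Q - normSq w = 4 * ‖V.det‖ := by
    rw [← hnormg, hdetg, Complex.norm_real, Real.norm_of_nonneg (sub_nonneg.2 hpq.le)]
  have hVdet0 : 0 < ‖V.det‖ := by
    have h4 : 0 < 4 * ‖V.det‖ := by rw [← hPQ]; exact sub_pos.2 hpq
    exact pos_of_mul_pos_right h4 (by norm_num)
  have hR0 : 0 ≤ R := (norm_nonneg _).trans (hR (Sum.inl 0) (Sum.inl 0))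
  have hEP1 : 1 ≤ (1 + P) * (1 + P⁻¹) := one_le_envFactor hp
  have hEt1 : 1 ≤ (1 + t) * (1 + t⁻¹) := one_le_envFactor ht
  have hEP0 : 0 ≤ (1 + P) * (1 + P⁻¹) := zero_le_one.trans hEP1
  have hE1 : 1 ≤ E := one_le_mul_of_one_le_of_one_le hEP1 hEt1
  have hE0 : 0 < E := zero_lt_one.trans_le hE1
  have hSz1 : 1 + R ≤ Sz := le_mul_of_one_le_left (by positivity) hE1
  have hESz : E ≤ Sz := le_mul_of_one_le_right hE0.le (le_add_of_nonneg_right hR0)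
  have hSzone : 1 ≤ Sz := (le_add_of_nonneg_right hR0).trans hSz1
  have hSz0 : 0 < Sz := zero_lt_one.trans_le hSzone
  have hPE' : (1 + P) * (1 + P⁻¹) ≤ E := le_mul_of_one_le_right hEP0 hEt1
  have hPSz : P ≤ Sz := (((le_envFactor hp).1.trans hPE').trans hESz)
  have hPinvSz : P⁻¹ ≤ Sz := (((le_envFactor hp).2.trans hPE').trans hESz)
  have hRSz : R ≤ Sz := ((le_add_of_nonneg_left zero_le_one).trans hSz1)
  /- (m2) at `l = Fin 2`: `|δ| ≤ 8R²`, `|δ|⁻¹ ≤ 32R²`, `|det V|⁻¹ ≤ 64R⁴` -/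
  have hδle : ‖δ‖ ≤ 8 * R ^ 2 := by
    have h1 : ‖δ‖ ≤ (Fintype.card (Fin 2)).factorial * (2 * R) ^ Fintype.card (Fin 2) := norm_det_denom_I_le hR
    simp only [Fintype.card_fin, Nat.factorial_two, Nat.cast_ofNat] at h1
    linarith only [h1]
  have hδinv : ‖δ‖⁻¹ ≤ 32 * R ^ 2 := by
    have h1 : ‖δ⁻¹‖ ≤ (Fintype.card (Fin 2)).factorial * (2 * (Fintype.card (Fin 2)) * R) ^ Fintype.card (Fin 2) :=
      norm_det_denom_I_inv_le hh hR
    simp only [Fintype.card_fin, Nat.factorial_two, Nat.cast_ofNat, norm_inv] at h1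
    linarith only [h1]
  have hVinv : ‖V.det‖⁻¹ ≤ 64 * R ^ 4 := by
    have h1 : ‖V.det‖⁻¹ ≤ ((Fintype.card (Fin 2)).factorial * (2 * R) ^ Fintype.card (Fin 2)) ^ 2 := inv_norm_det_im_moeb_I_le hh hR
    simp only [Fintype.card_fin, Nat.factorial_two, Nat.cast_ofNat] at h1
    linarith only [h1]
  have hEnvδ : (1 + ‖δ‖) * (1 + ‖δ‖⁻¹) ≤ 256 * Sz ^ 4 :=
    (envFactor_le_of_sq_bounds hδpos hR0 hδle hδinv).trans (mul_le_mul_of_nonneg_left (pow_le_pow_left₀ (by positivity) hSz1 4) (by norm_num))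
  /- (F1) `‖δ^{-k}‖ ≤ 256^{n₁}·Sz^{4n₁}` -/
  have hF1 : ‖δ ^ (-k)‖ ≤ (256 : ℝ) ^ n₁ * Sz ^ (4 * n₁) := by
    rw [norm_zpow, ← Real.rpow_intCast]
    have hx : |(((-k : ℤ)) : ℝ)| ≤ |(k : ℝ)| + 2 * z.re + 4 := by rw [Int.cast_neg, abs_neg]; linarith only [hz]
    calc ‖δ‖ ^ (((-k : ℤ)) : ℝ) ≤ ((1 + ‖δ‖) * (1 + ‖δ‖⁻¹)) ^ n₁ := rpow_le_envFactor_pow hδpos hx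
      _ ≤ (256 * Sz ^ 4) ^ n₁ := pow_le_pow_left₀ (by positivity) hEnvδ n₁
      _ = (256 : ℝ) ^ n₁ * Sz ^ (4 * n₁) := by rw [mul_pow, ← pow_mul]
  /- (F2) `‖|δ|^{k−2s−2}‖ ≤ 256^{n₁}·Sz^{4n₁}` -/
  have hF2 : ‖(((‖δ‖ : ℝ)) : ℂ) ^ ((k : ℂ) - 2 * s - 2)‖ ≤ (256 : ℝ) ^ n₁ * Sz ^ (4 * n₁) := by
    rw [Complex.norm_cpow_eq_rpow_re_of_pos hδpos]
    have hx : |((k : ℂ) - 2 * s - 2).re| ≤ |(k : ℝ)| + 2 * z.re + 4 := by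
      have hre : ((k : ℂ) - 2 * s - 2).re = (k : ℝ) - 2 * s.re - 2 := by simp only [sub_re, intCast_re, mul_re, re_ofNat, im_ofNat]; ring
      rw [hre]
      have h3 := abs_le.1 hres1
      rw [abs_le]; constructor <;> linarith only [le_abs_self (k : ℝ), neg_abs_le (k : ℝ), h3.1, h3.2, hz]
    calc ‖δ‖ ^ ((k : ℂ) - 2 * s - 2).re ≤ ((1 + ‖δ‖) * (1 + ‖δ‖⁻¹)) ^ n₁ := rpow_le_envFactor_pow hδpos hx
      _ ≤ (256 * Sz ^ 4) ^ n₁ := pow_le_pow_left₀ (by positivity) hEnvδ n₁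
      _ = (256 : ℝ) ^ n₁ * Sz ^ (4 * n₁) := by rw [mul_pow, ← pow_mul]
  /- (F3) the character has modulus `1` -/
  have hF3 : ‖cexp ((2 * Real.pi * I) * ((a * hermTwo (t, 0, 0) * aᴴ) * ((2 : ℂ)⁻¹ • (moeb h (I • (1 : Matrix (Fin 2) (Fin 2) ℂ)) +
      (moeb h (I • (1 : Matrix (Fin 2) (Fin 2) ℂ)))ᴴ))).trace)‖ = 1 := by
    refine norm_cexp_trace_mul_of_isHermitian (Matrix.isHermitian_mul_mul_conjTranspose a (isHermitian_hermTwo _)).eq ?_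
    rw [conjTranspose_smul, conjTranspose_add, conjTranspose_conjTranspose, add_comm]
    congr 1
    simp
  /- (F4)–(F7) the numerical constants -/
  have hF4 : ‖(1 / 8 : ℂ)‖ = 1 / 8 := by simp
  have hF5 : ‖(((4 * Real.pi ^ 4 : ℝ)) : ℂ)‖ = 4 * Real.pi ^ 4 := by rw [Complex.norm_real, Real.norm_of_nonneg (by positivity)]
  have hF6 : ‖cexp ((Real.pi * I) * ((s + 1 - k / 2) - (s + 1 + k / 2)))‖ = 1 := by
    rw [show (Real.pi * I) * ((s + 1 - k / 2) - (s + 1 + k / 2)) = ((-(Real.pi * (k : ℝ)) : ℝ) : ℂ) * I by push_cast; ring,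
      Complex.norm_exp_ofReal_mul_I]
  have hF7 : ‖(Real.pi : ℂ)⁻¹‖ = Real.pi⁻¹ := by rw [norm_inv, Complex.norm_real, Real.norm_of_nonneg Real.pi_pos.le]
  have hsB1 : s ∈ closedBall z 1 := mem_closedBall.2 hs1.le
  have hΓ₁ : ‖(Complex.Gamma (s + 1 + k / 2))⁻¹‖ ≤ C₁ := hC₁ s hsB1
  have hΓ₂ : ‖(Complex.Gamma (s + 1 + k / 2 - 1))⁻¹‖ ≤ C₂ := hC₂ s hsB1
  have hΓ₃ : ‖(Complex.Gamma (s + 1 - k / 2))⁻¹‖ ≤ C₃ := hC₃ s hsB1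
  /- (F9) `‖π/P‖ ≤ π·Sz`; (F10) the Gaussian -/
  have hF9 : ‖(Real.pi : ℂ) / (P : ℂ)‖ ≤ Real.pi * Sz := by
    rw [norm_div, Complex.norm_real, Complex.norm_real, Real.norm_of_nonneg Real.pi_pos.le, Real.norm_of_nonneg hp.le, div_eq_mul_inv]
    exact mul_le_mul_of_nonneg_left hPinvSz Real.pi_pos.le
  have hF10 : ‖cexp (-(((P * (Real.pi * t) : ℝ)) : ℂ))‖ = Real.exp (-(Real.pi * (P * t))) := by
    rw [← ofReal_neg, Complex.norm_exp_ofReal]; ring_nf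
  /- (F12) `Γ(2s)`; (F13) the witness (before sealing the abbreviations: `E` must unfold here) -/
  have hΓ₄ : ‖Complex.Gamma (2 * s)‖ ≤ C₄ := hC₄ s (mem_closedBall.2 hs2.le)
  have hF13 : ‖Φ (1 + k / 2) (1 - k / 2) P s‖ ≤ CΦ * Sz ^ K :=
    (hΦbd t ht Φ hΦb hΦc P hp s hsΦ).trans (mul_le_mul_of_nonneg_left (pow_le_pow_left₀ hE0.le hESz K) hCΦ)
  have hn₂s : 2 * s.re ≤ n₂ := by
    have h1 : 2 * z.re + 2 ≤ n₂ := Nat.le_ceil _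
    have h2 := hsre1.2
    rw [sub_re] at h2
    linarith only [h1, h2]
  /- seal the abbreviations: from here on `V g P Q w δ E Sz n₁ n₂` are opaque atoms (cheap `linarith`/`ring`/`gcongr`) -/
  clear_value Sz E δ w Q P g V n₂ n₁
  /- (F11) `‖(1/(Q − |w|²/P))^{2s}‖ ≤ 16^{n₂}·Sz^{5n₂}` -/
  have hx₀eq : 1 / (Q - normSq w / P) = P / (4 * ‖V.det‖) := by
    rw [← hPQ]
    have hQ' : Q - normSq w / P = (P * Q - normSq w) / P := by rw [sub_div, mul_div_cancel_left₀ Q hp.ne']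
    rw [hQ', one_div_div]
  have hx₀pos : 0 < 1 / (Q - normSq w / P) := by rw [hx₀eq]; positivity
  have hx₀le : 1 / (Q - normSq w / P) ≤ 16 * Sz ^ 5 := by
    rw [hx₀eq]
    calc P / (4 * ‖V.det‖) = (P / 4) * ‖V.det‖⁻¹ := by rw [div_mul_eq_div_div, div_eq_mul_inv]
      _ ≤ (Sz / 4) * (64 * R ^ 4) := mul_le_mul (by linarith) hVinv (inv_nonneg.2 (norm_nonneg _)) (by positivity)
      _ = 16 * (Sz * R ^ 4) := by ring
      _ ≤ 16 * (Sz * Sz ^ 4) := by gcongr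
      _ = 16 * Sz ^ 5 := by ring
  have hF11 : ‖((1 : ℂ) / ((Q - normSq w / P : ℝ) : ℂ)) ^ ((s + 1 + k / 2) + (s + 1 - k / 2) - 2)‖ ≤ (16 : ℝ) ^ n₂ * Sz ^ (5 * n₂) := by
    have hcast : (1 : ℂ) / ((Q - normSq w / P : ℝ) : ℂ) = (((1 / (Q - normSq w / P) : ℝ)) : ℂ) := by
      rw [Complex.ofReal_div, Complex.ofReal_one]
    rw [hcast, Complex.norm_cpow_eq_rpow_re_of_pos hx₀pos]
    have hre : ((s + 1 + k / 2) + (s + 1 - k / 2) - 2 : ℂ).re = 2 * s.re := by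
      simp only [add_re, sub_re, one_re, div_ofNat_re, intCast_re, re_ofNat]; ring
    rw [hre]
    have h16 : (1 : ℝ) ≤ 16 * Sz ^ 5 := by linarith [one_le_pow₀ (M₀ := ℝ) (n := 5) hSzone]
    calc (1 / (Q - normSq w / P)) ^ (2 * s.re) ≤ (16 * Sz ^ 5) ^ (2 * s.re) := Real.rpow_le_rpow hx₀pos.le hx₀le (by linarith)
      _ ≤ (16 * Sz ^ 5) ^ ((n₂ : ℕ) : ℝ) := Real.rpow_le_rpow_of_exponent_le h16 hn₂s
      _ = (16 : ℝ) ^ n₂ * Sz ^ (5 * n₂) := by rw [Real.rpow_natCast, mul_pow, ← pow_mul]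
  simp only [norm_mul]
  rw [hF3, hF4, hF5, hF6, hF7, hF10]
  calc _ ≤ ((256 : ℝ) ^ n₁ * Sz ^ (4 * n₁)) * ((256 : ℝ) ^ n₁ * Sz ^ (4 * n₁)) * 1 *
        (1 / 8 * (4 * Real.pi ^ 4 * 1 * (Real.pi⁻¹ * C₁ * C₂) * (Real.pi⁻¹ * C₃) *
          ((Real.pi * Sz) * Real.exp (-(Real.pi * (P * t))) * (((16 : ℝ) ^ n₂ * Sz ^ (5 * n₂)) * C₄) * (CΦ * Sz ^ K)))) := by
        gcongr
    _ = (256 : ℝ) ^ n₁ * (256 : ℝ) ^ n₁ * (1 / 8) * (4 * Real.pi ^ 4) * (Real.pi⁻¹ * C₁ * C₂) * (Real.pi⁻¹ * C₃) * Real.pi * ((16 : ℝ) ^ n₂ * C₄) * CΦ *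
        Sz ^ (4 * n₁ + 4 * n₁ + 1 + 5 * n₂ + K) * Real.exp (-(Real.pi * (P * t))) := by ring

end Summit.HodgeConjecture.HodgeConjecture.Cruxes.HLiu418.K2LiuArchTwistedScalarLettersGrowth

end
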